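/-
Copyright (c) 2026 the pub-hodgecm-mathlib formalisation cell (harness21).  Prover seat hodgecm-mathlib-K2E1-p02 (g2), Track B ∕ K2-LIT
(build stream 29), h413 = `stmt-HodgeConjecture-24833`, line `K2_E1_TraceFormulaBeta`, socket module «GlobalIndex» ED. 9∕10 — payer
programme of `sig_K2E1CuspCompactU2` :226, the (E) port, DEFINITIONS LEAF ED. 4 (the block-nilpotent coordinate of the Siegel radical); dealer
K2E1-plan (g0) standing queue 2026-09-03T23:50:06Z (brick B3 `SiegelKernel`).  2026-09-04.
-/
import Summits.HodgeConjecture.HodgeConjecture.Theorems.K2E1SiegelRadicalChartU2Defs   -- K2E1-p02 (g2) ★ p855921: the chart `unipotentU2` (`n(x) = [[1,x],[0,1]]`)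
import Literature.NumberTheory.Automorphic.GLnCuspidalSiegelKernel                     -- ★ `finIntegralBlock`, `blockArchPart`, `siegelKernelSlice` (the `GL_n` kernel bricks)
import HarnessLib

/-!
# h413 ∕ Track B «K2-LIT», line `K2_E1_TraceFormulaBeta`, «GlobalIndex» — DEFINITIONS LEAF ED. 4 `K2E1SiegelRadicalBlockU2Defs`:
# the block-nilpotent coordinate `Y : 𝔸_L⁻ →+ 𝔫₁(𝔸_L)`, `Y(x) = x E₀₁`, of the Siegel radical of `U(Φ₂)`

Cell `pub/hodgecm-mathlib`, crux H413 = `stmt-HodgeConjecture-24833`, route of record `HCCMUnconditional`; chair K2-lead (g0), dealer K2E1-plan (g0)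
(standing queue 23:50:06Z: the (E) port = [GetzHahn2024 Prop. 9.6.1] for `U(Φ₂)`, SPEC `K2/K2E1-p02/g2/SPEC-E-cone-U2.K2E1-p02-g2.md`, brick B3 «kernel»).
The tree's PROVED `GL_n` kernel bricks (★ `GLnCuspidalSiegelKernel`: `siegelKernelSlice`, `finIntegralBlock`, `iterFwdDiff_siegelKernelSlice_eq_zero`,
`norm_iterFwdDiff_translate_leftArchSlice_le`, `norm_siegelArchStep_le`) are typed over the block-nilpotent matrices `𝔫_k(𝔸_K) =` ★ `blockNilpotent n k`; the
(E) port for `U(Φ₂) ≤ GL₂(𝔸_L)` reuses them VERBATIM (`n = 2`, `k = 1`, `K = L`, test function `η₀ : GL₂(𝔸_L) → ℝ`) once the additive chart of the Siegel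
radical (★ p855921 `unipotentU2` on `𝔸_L⁻ =` ★ `traceZeroAdele`) is composed with the ONE definition of this leaf (lane `--kind definition --supports
stmt-HodgeConjecture-24833 --as helper`; no `instance`, no `notation`, no named-fact hypothesis, no `sorry`):

* `blockOfTraceZero L : 𝔸_L⁻ →+ 𝔫₁(𝔸_L)` — `Y(x) = x · E₀₁` (Mathlib `Matrix.single 0 1 x`), an additive homomorphism into ★ `blockNilpotent 2 1 (AdeleRing (𝓞 L) L)`.

API (theorems): `coe_blockOfTraceZero` (the matrix), **`unipotentOfBlock_blockOfTraceZero`** (`1 + Y(x) = n(x)` in `GL₂(𝔸_L)`: ★ `unipotentOfBlock` of the coordinate IS the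
matrix ★ `adelicVal (unipotentU2 x)` — definitional), `blockOfTraceZero_injective`, `continuous_blockOfTraceZero`, and the LEVEL LEMMA
**`blockOfTraceZero_sub_blockArchPart_mem_finIntegralBlock`** (if the finite part of `x` is `c · y` with `y` integral then `Y(x) − Y(x)_∞ ∈` ★ `finIntegralBlock c`,
the hypothesis under which finite steps drop out of the kernel differences, ★ `siegelKernelSlice_add_of_mem`).

HONEST LABEL.  Count-neutral definitions leaf; closes no socket by itself; HC_CM is proved only modulo the 7 printed citations (2 remaining named inputs:
hLiu418 = `stmt-HodgeConjecture-24832`, h413 = `stmt-HodgeConjecture-24833`) until rung 0 closes.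

## References
* [GetzHahn2024] J. R. Getz, H. Hahn, *An Introduction to Automorphic Representations*, GTM 300 (2024), §9.5–9.6 (printed pp. 186–190).
* [Garrett2018] P. Garrett, *Modern Analysis of Automorphic Forms by Example* (2018), §7.3, Claims 7.3.6–7.3.9 (PDF pp. 336–342).
* [BorelJacquet1979] A. Borel, H. Jacquet, Corvallis PSPM 33.1 (1979), §4.4.
-/

set_option autoImplicit false
-- the mandated namespace repeats `HodgeConjecture.HodgeConjecture`, as in every `Theorems/*.lean` of this sub-problem
set_option linter.dupNamespace false

noncomputable section

open NumberField IsDedekindDomain Set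
open scoped NNReal MatrixGroups

namespace Summit.HodgeConjecture.HodgeConjecture.Cruxes.H413.K2E1SiegelRadicalBlockU2

open Literature.NumberTheory.Automorphic Literature.NumberTheory.Automorphic.UnitaryGroup
open Summit.HodgeConjecture.HodgeConjecture.Cruxes.H413.K2E1SiegelRadicalChartU2

variable (L : Type) [Field L] [NumberField L] [IsCMField L]

/-- **The block-nilpotent coordinate `Y : 𝔸_L⁻ →+ 𝔫₁(𝔸_L)`, `Y(x) = x E₀₁`** (Mathlib `Matrix.single 0 1 x`), on the trace-zero adeles (★ `traceZeroAdele L⁺ L c`), with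
values in ★ `blockNilpotent 2 1 (AdeleRing (𝓞 L) L)` — the additive letter in which the ★ `GL_n` kernel bricks are typed; `1 + Y(x) = n(x)`
(`unipotentOfBlock_blockOfTraceZero`). [cite: Garrett2018, Claim 7.3.6 (PDF p. 336)] [cite: BorelJacquet1979, §4.4] -/
def blockOfTraceZero : ↥(traceZeroAdele (↥(maximalRealSubfield L)) L (IsCMField.complexConj L)) →+ blockNilpotent 2 1 (AdeleRing (𝓞 L) L) where
  toFun X := ⟨Matrix.single 0 1 (X : AdeleRing (𝓞 L) L), fun i j hij => by
    rw [Matrix.single_apply] at hij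
    split_ifs at hij with h
    · obtain ⟨rfl, rfl⟩ := h
      exact ⟨by decide, by decide⟩
    · exact absurd rfl hij⟩
  map_zero' := by
    refine Subtype.ext ?_
    change Matrix.single 0 1 ((0 : ↥(traceZeroAdele (↥(maximalRealSubfield L)) L (IsCMField.complexConj L))) : AdeleRing (𝓞 L) L) = 0
    simp
  map_add' X Y := by
    refine Subtype.ext ?_
    change Matrix.single 0 1 ((X + Y : ↥(traceZeroAdele (↥(maximalRealSubfield L)) L (IsCMField.complexConj L))) : AdeleRing (𝓞 L) L) =
      Matrix.single 0 1 (X : AdeleRing (𝓞 L) L) + Matrix.single 0 1 (Y : AdeleRing (𝓞 L) L)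
    rw [AddSubgroup.coe_add, Matrix.single_add]

/-- The matrix of `Y(x)` is `x E₀₁` (definitional). [cite: Garrett2018, Claim 7.3.6 (PDF p. 336)] -/
theorem coe_blockOfTraceZero (X : ↥(traceZeroAdele (↥(maximalRealSubfield L)) L (IsCMField.complexConj L))) :
    ((blockOfTraceZero L X : blockNilpotent 2 1 (AdeleRing (𝓞 L) L)) : Matrix (Fin 2) (Fin 2) (AdeleRing (𝓞 L) L)) =
      Matrix.single 0 1 (X : AdeleRing (𝓞 L) L) :=
  rfl

/-- Entries of `Y(x)`. [cite: Garrett2018, Claim 7.3.6 (PDF p. 336)] -/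
theorem blockOfTraceZero_apply (X : ↥(traceZeroAdele (↥(maximalRealSubfield L)) L (IsCMField.complexConj L))) (i j : Fin 2) :
    ((blockOfTraceZero L X : blockNilpotent 2 1 (AdeleRing (𝓞 L) L)) : Matrix (Fin 2) (Fin 2) (AdeleRing (𝓞 L) L)) i j =
      if i = 0 ∧ j = 1 then (X : AdeleRing (𝓞 L) L) else 0 := by
  rw [coe_blockOfTraceZero, Matrix.single_apply]
  by_cases h : i = 0 ∧ j = 1
  · rw [if_pos h, if_pos ⟨h.1.symm, h.2.symm⟩]
  · rw [if_neg h, if_neg fun h' => h ⟨h'.1.symm, h'.2.symm⟩]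

/-- **`1 + Y(x) = n(x)` in `GL₂(𝔸_L)`**: the ★ `unipotentOfBlock` of the coordinate is the matrix (★ `adelicVal`) of the chart element ★ `unipotentU2 L x` — both are
`1 + x E₀₁` (definitional: ★ `middleRootMatrix 2 0 1 x = 1 + Matrix.single 0 1 x`). [cite: Garrett2018, Claim 7.3.6 (PDF p. 336)] [cite: BorelJacquet1979, §4.4] -/
theorem unipotentOfBlock_blockOfTraceZero (X : ↥(traceZeroAdele (↥(maximalRealSubfield L)) L (IsCMField.complexConj L))) :
    unipotentOfBlock 2 1 (AdeleRing (𝓞 L) L) (Multiplicative.ofAdd (blockOfTraceZero L X)) =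
      adelicVal (↥(maximalRealSubfield L)) L (IsCMField.complexConj L) 2
        (Matrix.of fun i j : Fin 2 => if i.val + j.val + 1 = 2 then (1 : L) else 0) (unipotentU2 L (Multiplicative.ofAdd X)) :=
  Units.ext (by rw [coe_unipotentOfBlock, adelicVal_unipotentU2]; rfl)

/-- The coordinate is injective. [folklore] -/
theorem blockOfTraceZero_injective : Function.Injective (blockOfTraceZero L) := by
  intro X Y h
  have h' := congrArg (fun M : blockNilpotent 2 1 (AdeleRing (𝓞 L) L) => (M : Matrix (Fin 2) (Fin 2) (AdeleRing (𝓞 L) L)) 0 1) h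
  simp only [blockOfTraceZero_apply, true_and, if_true] at h'
  exact Subtype.ext h'

/-- The coordinate is continuous. [folklore] -/
theorem continuous_blockOfTraceZero : Continuous (blockOfTraceZero L) := by
  refine Continuous.subtype_mk (continuous_matrix fun i j => ?_) _
  change Continuous fun X : ↥(traceZeroAdele (↥(maximalRealSubfield L)) L (IsCMField.complexConj L)) =>
    Matrix.single 0 1 (X : AdeleRing (𝓞 L) L) i j
  simp only [Matrix.single_apply]
  split_ifs
  · exact continuous_subtype_val
  · exact continuous_const

/-- **THE LEVEL LEMMA**: if the finite part of `x ∈ 𝔸_L⁻` is `c · y` with `y` an integral finite adele (`c ∈ 𝓞 L`), then `Y(x)` differs from its archimedean part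
`Y(x)_∞` (★ `blockArchPart`) by an element of ★ `finIntegralBlock c` — the hypothesis under which the finite parts of the steps drop out of the kernel
differences (★ `siegelKernelSlice_add_of_mem`, ★ `IsTestFunctionGL.exists_int_forall_unipotentOfBlock_mul_eq`). [cite: Garrett2018, Thm. 7.3.10 (PDF p. 340)] -/
theorem blockOfTraceZero_sub_blockArchPart_mem_finIntegralBlock {c : 𝓞 L}
    {X : ↥(traceZeroAdele (↥(maximalRealSubfield L)) L (IsCMField.complexConj L))}
    (hX : ∃ y ∈ integralFiniteAdeles L, (X : AdeleRing (𝓞 L) L).2 = algebraMap (𝓞 L) (FiniteAdeleRing (𝓞 L) L) c * y) :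
    blockOfTraceZero L X - blockArchPart (blockOfTraceZero L X) ∈ finIntegralBlock c := by
  rw [mem_finIntegralBlock_iff]
  refine ⟨fun i j => ?_, fun i j => ?_⟩
  · change (((blockOfTraceZero L X : blockNilpotent 2 1 (AdeleRing (𝓞 L) L)) : Matrix (Fin 2) (Fin 2) (AdeleRing (𝓞 L) L)) i j).1 -
        (((blockArchPart (blockOfTraceZero L X) : blockNilpotent 2 1 (AdeleRing (𝓞 L) L)) : Matrix (Fin 2) (Fin 2) (AdeleRing (𝓞 L) L)) i j).1 = 0
    rw [fst_blockArchPart_apply, sub_self]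
  · change ∃ y ∈ integralFiniteAdeles L,
      (((blockOfTraceZero L X : blockNilpotent 2 1 (AdeleRing (𝓞 L) L)) : Matrix (Fin 2) (Fin 2) (AdeleRing (𝓞 L) L)) i j).2 -
        (((blockArchPart (blockOfTraceZero L X) : blockNilpotent 2 1 (AdeleRing (𝓞 L) L)) : Matrix (Fin 2) (Fin 2) (AdeleRing (𝓞 L) L)) i j).2 = _
    rw [snd_blockArchPart_apply, sub_zero, blockOfTraceZero_apply]
    by_cases h : i = 0 ∧ j = 1
    · rw [if_pos h]
      exact hX
    · rw [if_neg h]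
      exact ⟨0, zero_mem _, by rw [mul_zero]; rfl⟩

end Summit.HodgeConjecture.HodgeConjecture.Cruxes.H413.K2E1SiegelRadicalBlockU2

end
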